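import Summits.BirchSwinnertonDyer.BirchSwinnertonDyer.Theorems.EisensteinPrimesBSDpOnCellCWallAlgebraicOfPub
import Literature.NumberTheory.EllipticCurves.HeegnerPoints
import HarnessLib

/-!
# The `ψ`-side of Keller–Yin Thm. 1.2.2 for the Teichmüller pair of a rational `p`-line at ANY odd multiplicative (indeed any) `p` split in
# `K` — reduction-type-free core — and crux 4's NON-SPLIT wall [BRω-mult] HEAVY (the `hω` binder of
# `CharGrSelmerCorankGeOfFacts.imprimitiveCount_nonsplit_of_an_of_brPrinted_of_ge` / `…_of_pub''`) from FOUR PUBLISHED named facts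
# (helper for crux 4 `BSDpOnCellC`, stmt-BirchSwinnertonDyer-19034; cell `bsd-eis`, width seat `bsd-line-x2-p2` gen 17)

WHY. The compositions V8–V18 of crux 4 feed the non-split imprimitive count its ω-side binder `hω` ([BRω-mult] HEAVY: for the `p`-RAMIFIED member
`ψ` of the Teichmüller pair at a NON-split multiplicative `p`, every unramified `Λ`-dual `D_ψ` at `𝔭bar` is finitely generated torsion with `μ = 0` and
`λ(D_ψ) = n_φ`) through `KellerYinBROmegaLightBridges.brOmegaMult_heavy_of_light (BrOmegaMultOfPrint.brOmegaMult_light_of_print hfe)`, i.e. from the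
PUBLISHED named fact `CastellaGrossiLeeSkinner2022.thm122_fe_omegaPartner_charGrDual_torsion_muZero_lambda_eq` (CGLS Thm. 1.2.2 for the ω-partner in
the printed regime `ψ|_{G_v̄} ∉ {𝟙, ω}`, strict-dual currency; x2-p2 g12). But this seat's `ResidualPairMuLambdaOfPub.omegaSide_of_pub_of_firstUnit`
(p723824) proves the ω-side for EVERY local type from Rubin's h_K-free two-variable main conjecture (Bleher et al. 2020 Thm. 3.3.1), Greenberg 2016
Prop. 4.1.1, de Shalit II.6.4 and Hida 2010 Thm. I — and `BSDpOnCellCWallAlgebraicOfPub.wallAlgebraicTwo_of_pub` (p724100) used it only under the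
«split» binder, which its proof never touches. This file states the REDUCTION-TYPE-FREE core once (§1) and derives `hω`'s text VERBATIM (§2), so that a
composition can drop `thm122_fe_omegaPartner_…` from its cite text: the character-level ω-side then rests on the SAME four refereed names at split AND
non-split `p`.

* §1 `omegaSideTeichmullerPair_of_pub` — `wallAlgebraicTwo_of_pub`'s statement WITHOUT `Mult W p → W.HasSplitMultiplicativeReductionAtPrime p →`
  (proof token for token: `ι := X11b.embAt`, `C := N·p`, (K-det) `entry_mul_entry_eq_teichmullerChar`, unramifiedness off `N·p` from the Teichmüller typing,
  `ψ|_K ≠ 𝟙` by `restrictField_ne_one_of_entry_mul_eq_teichmullerChar`).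
* §2 `brOmegaMultHeavy_of_pub` — the `hω` binder text of `…ImprimitiveCountNonsplitOfGe` / `…NonsplitOfPrint` VERBATIM (CellC, non-split, X2c Heegner
  datum binders — all idle but `CellC`'s `p ≠ 2` and `D_K < −4`).

HONEST FRAMING: CONDITIONAL on four PUBLISHED theorems stated as named facts; THEOREMS ONLY (0 definitions, 0 named facts, 0 sorry); closes no stub by
itself; no summit statement / BSD / main conjecture is proved for any curve; 0 cells / labels / tiers move.
References: as in `…ResidualPairMuLambdaOfPub`, `…BSDpOnCellCWallAlgebraicOfPub`; [CastellaGrossiLeeSkinner2022] Thm. 1.2.2 with (2.16);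
[KellerYin2024] Thm. 1.2.2, Lemma 1.2.4, §5.1 (b) (arXiv:2402.12781v2; shape only).
-/

-- the summit namespace `Summit.BirchSwinnertonDyer.BirchSwinnertonDyer` repeats the problem name by design (D-0017)
set_option linter.dupNamespace false
set_option autoImplicit false

noncomputable section

open scoped Classical

open Filter PowerSeries WeierstrassCurve NumberField IsDedekindDomain Field
  Literature.NumberTheory.GaloisRepresentations Literature.NumberTheory.GaloisRepresentations.HeckeCharacter
  Literature.NumberTheory.EllipticCurves Literature.NumberTheory.EllipticCurves.GreenbergVatsal2000
  Literature.NumberTheory.EllipticCurves.GreenbergSelmer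
  Literature.NumberTheory.EllipticCurves.ModularForms
  Literature.NumberTheory.EllipticCurves.CastellaGrossiLeeSkinner2022
  Literature.NumberTheory.EllipticCurves.KellerYin2024 Literature.NumberTheory.EllipticCurves.Rank1Residual
  Literature.NumberTheory.EllipticCurves.Rubin1991 Literature.NumberTheory.EllipticCurves.DeShalit1987
  Literature.NumberTheory.EllipticCurves.Hida2010MuInvariant Literature.NumberTheory.EllipticCurves.BCGKPST2020
  Literature.NumberTheory.EllipticCurves.IwasawaAlgebra Literature.NumberTheory.EllipticCurves.Castella2018
  Literature.NumberTheory.EllipticCurves.ZpExtension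
  Literature.NumberTheory.IwasawaTheory Literature.NumberTheory.IwasawaTheory.Greenberg2016
  Literature.NumberTheory.IwasawaTheory.Greenberg2006
  Summit.BirchSwinnertonDyer.Rank1Residual Summit.BirchSwinnertonDyer.Rank1Residual.X11b
  Summit.BirchSwinnertonDyer.Rank1Residual.X11b.Halves
  Summit.BirchSwinnertonDyer.Rank1Residual.X1.KellerYinMuLambdaSplit
  Summit.BirchSwinnertonDyer.Rank1Residual.X2
  Summit.BirchSwinnertonDyer.BirchSwinnertonDyer.Theorems.IwasawaTwoVariable
  Summit.BirchSwinnertonDyer.BirchSwinnertonDyer.Theorems.EisensteinPrimesMuLambda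
  Summit.BirchSwinnertonDyer.BirchSwinnertonDyer.Theorems.BSDpOnCellCWallAlgebraicOfPub

namespace Summit.BirchSwinnertonDyer.BirchSwinnertonDyer.Theorems.BrOmegaMultHeavyOfPub

/-! ## §1 The reduction-type-free core -/

/-- **The `ψ`-side for the Teichmüller pair of a rational `p`-line, ANY reduction type at `p`** (`p > 2` split in `K` as a degree-one `𝔭`
with partner `𝔭bar`, `K` Heegner for `N` with `D_K` odd `≠ −3`, either labelling `(φ, ψ)` with `φ` unramified at `p`): `λ(D_ψ) = n_φ`, torsion,
`μ = 0`, for every CGLS frame of the Hecke character of `φ|_K` with first unit at `n_φ` — from Bleher et al. 2020 Thm. 3.3.1, Greenberg 2016 Prop.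
4.1.1, de Shalit II.6.4, Hida 2010 Thm. I. Proof = `BSDpOnCellCWallAlgebraicOfPub.wallAlgebraicTwo_of_pub`'s, which never used its reduction-type binders.
[cite: KellerYin2024, Thm. 1.2.2, Lemma 1.2.4 (arXiv:2402.12781v2) (shape only)] [cite: CastellaGrossiLeeSkinner2022, Thm. 1.2.2 with (2.16)]
[cite: BleherEtAl2020, §3.3 Thm. 3.3.1] [cite: Greenberg2016Selmer, Prop. 4.1.1] [cite: deShalit1987, II.6.4] [cite: Hida2010MuInvariant, Thm. I] -/
theorem omegaSideTeichmullerPair_of_pub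
    (h331 : thm331_rubin_exists_katzMeasure₂_pseudoIso_span_eq)
    (h411 : prop411_selmer_isAlmostDivisible)
    (hF : thmII64_katzMeasure₂_functionalEquation) (hO1 : thmI_mu_katzBranch_reflect_eq_zero) :
    ∀ (W : WeierstrassCurve ℚ) [W.IsElliptic] [W.IsGloballyMinimal] (p : ℕ) [Fact p.Prime],
      2 < p →
      ∀ (K : Type) [Field K] [NumberField K],
        IsImaginaryQuadratic K → SatisfiesHeegnerHypothesis (W.conductorNorm ℤ) K →
        Odd (NumberField.discr K) → NumberField.discr K ≠ -3 →
        ∀ (κ : ZpExtension K p), κ.IsAnticyclotomic →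
          ∀ (γ : Field.absoluteGaloisGroup K) [Fact (κ.IsTopGenerator γ)]
            (𝔭 : HeightOneSpectrum (𝓞 K)), ((p : ℕ) : 𝓞 K) ∈ 𝔭.asIdeal →
            𝔭.asIdeal.ramificationIdx (𝓞 ℚ) = 1 → 𝔭.asIdeal.inertiaDeg (𝓞 ℚ) = 1 →
            ∀ (𝔭bar : HeightOneSpectrum (𝓞 K)), ((p : ℕ) : 𝓞 K) ∈ 𝔭bar.asIdeal → 𝔭bar ≠ 𝔭 →
              ((Ideal.span {(p : ℤ)}).primesOver (𝓞 K)).ncard = 2 →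
            ∀ (ι' : PadicAlgCl p ≃+* ℂ),
              (∀ (w : InfinitePlace K) (k : 𝓞 K), k ∈ 𝔭.asIdeal ↔ ‖ι'.symm (w.embedding (k : K))‖ < 1) →
            ∀ (Φ : AddSubgroup (geomTorsion W (p : ℤ))), IsRationalLine W p Φ →
            ∀ (θsub θquot : FramedGaloisRep ℚ (padicCoeffIntegers (∅ : Set (PadicAlgCl p))) 1),
              IsTeichmullerLiftOn (∅ : Set (PadicAlgCl p)) (Φ.map (geomTorsion W (p : ℤ)).subtype) θsub →
              IsTeichmullerLiftOnQuot (∅ : Set (PadicAlgCl p)) (Φ.map (geomTorsion W (p : ℤ)).subtype)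
                (geomTorsion W (p : ℤ)) θquot →
            ∀ (φ ψ : FramedGaloisRep ℚ (padicCoeffIntegers (∅ : Set (PadicAlgCl p))) 1),
              (φ = θsub ∧ ψ = θquot ∨ φ = θquot ∧ ψ = θsub) →
              (∀ u : HeightOneSpectrum (𝓞 ℚ), ((p : ℕ) : 𝓞 ℚ) ∈ u.asIdeal → φ.IsUnramifiedAt u) →
            ∀ (θK : HeckeCharacter K), IsHeckeCharOf ι' (φ.restrictField K) θK →
            ∀ (Cbar : Finset (HeightOneSpectrum (𝓞 K))), (∀ u ∈ Cbar, ¬ θK.IsUnramifiedAt u) →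
            ∀ (ΩK' : ℂ) (Ωp' : (unrIntegers p)ˣ) (Lφ : UnrSeries p), ΩK' ≠ 0 →
              IsKatzLFunction ι' 𝔭 𝔭bar Cbar κ γ θK ΩK' ((Ωp' : unrIntegers p) : ℂ_[p]) Lφ →
            ∀ nφ : ℕ, FirstUnitCoeffAt Lφ nφ →
            ∀ (Dψ : DatumDualData κ γ (charModule (∅ : Set (PadicAlgCl p)) (ψ.restrictField K))
                (Castella2018.AcSelmer.bdpData (charModule (∅ : Set (PadicAlgCl p)) (ψ.restrictField K)) p 𝔭bar)
                (∅ : Set (HeightOneSpectrum (𝓞 K)))),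
              Module.Finite (IwasawaAlgebra p) Dψ.X ∧ Module.IsTorsion (IwasawaAlgebra p) Dψ.X ∧
                muInvariant p Dψ.X = 0 ∧ lambdaInvariant p Dψ.X = nφ := by
  intro W _ _ p _ hp K _ _ hK hHN hodd h3 κ hκ γ _ 𝔭 h𝔭 he1 hf1 𝔭bar h𝔭bar hne hncard
    ι' hι' Φ hΦ θsub θquot hsub hquot φ ψ hφψ hφp θK hθK Cbar hCbar ΩK' Ωp' Lφ hΩK' hL nφ hnφ Dψ
  have hprime : p.Prime := Fact.out
  have hp2 : p ≠ 2 := by omega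
  haveI : NeZero (p : ℚ) := ⟨by exact_mod_cast hprime.ne_zero⟩
  -- `Heeg(p)` from the splitting of `p`
  have hHp : SatisfiesHeegnerHypothesis p K := fun q hq hqp ↦ by
    rw [(Nat.prime_dvd_prime_iff_eq hq hprime).mp hqp]; exact hncard
  -- the embedding reading `𝔭`
  set ι : K →+* ℚ_[p] := X11b.embAt K p 𝔭 h𝔭 he1 hf1 with hιdef
  have hιv : ∀ x : 𝓞 K, x ∈ 𝔭.asIdeal ↔ ‖ι (x : K)‖ < 1 := X11b.mem_asIdeal_iff_norm_embAt_lt_one 𝔭 h𝔭 he1 hf1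
  -- the Teichmüller pair: torsion, (K-det), unramified off `N·p`
  have hcardΦ : Nat.card (Φ.map (geomTorsion W (p : ℤ)).subtype) = p := by
    rw [Nat.card_congr (Φ.equivMapOfInjective (geomTorsion W (p : ℤ)).subtype
      (geomTorsion W (p : ℤ)).subtype_injective).toEquiv.symm, hΦ.1]
  have hleΦ : Φ.map (geomTorsion W (p : ℤ)).subtype ≤ geomTorsion W (p : ℤ) := AddSubgroup.map_subtype_le Φ
  have hTsub : ∀ τ : absoluteGaloisGroup ℚ, θsub τ ^ (p - 1) = 1 := hsub.1
  have hTquot : ∀ τ : absoluteGaloisGroup ℚ, θquot τ ^ (p - 1) = 1 := hquot.1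
  have hdet0 := fun τ : absoluteGaloisGroup ℚ ↦
    entry_mul_entry_eq_teichmullerChar W (∅ : Set (PadicAlgCl p)) hcardΦ hleΦ hsub hquot τ
  set N : ℕ := W.conductorNorm ℤ with hNdef
  have hN0 : N ≠ 0 := (W.conductorNorm_pos_holds).ne'
  have hC0 : N * p ≠ 0 := Nat.mul_ne_zero hN0 hprime.ne_zero
  have hC : SatisfiesHeegnerHypothesis (N * p) K := fun q hq hqd ↦ by
    rcases (Nat.Prime.dvd_mul hq).mp hqd with h | h
    · exact hHN q hq h
    · exact hHp q hq h
  have hsubC : ∀ u : HeightOneSpectrum (𝓞 ℚ), (((N * p : ℕ) : ℤ) : 𝓞 ℚ) ∉ u.asIdeal → θsub.IsUnramifiedAt u :=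
    isUnramifiedAt_subChar_of_conductorNorm_mul_notMem W (∅ : Set (PadicAlgCl p)) hcardΦ hleΦ hsub
  have hquotC : ∀ u : HeightOneSpectrum (𝓞 ℚ), (((N * p : ℕ) : ℤ) : 𝓞 ℚ) ∉ u.asIdeal →
      θquot.IsUnramifiedAt u := by
    intro u hu
    have hN : ((W.conductorNorm ℤ : ℤ) : 𝓞 ℚ) ∉ u.asIdeal := fun h ↦ hu (by
      push_cast
      exact u.asIdeal.mul_mem_right _ (by exact_mod_cast h))
    have hpu : ((p : ℕ) : 𝓞 ℚ) ∉ u.asIdeal := fun h ↦ hu (by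
      push_cast
      exact u.asIdeal.mul_mem_left _ (by exact_mod_cast h))
    exact isUnramifiedAt_of_isTeichmullerLiftOnQuot W (∅ : Set (PadicAlgCl p)) hcardΦ hquot
      (hasGoodReductionAt_of_conductorNorm_notMem W u hN) hpu
  -- the labelling
  have hpairφψ : (∀ τ : absoluteGaloisGroup ℚ, φ τ ^ (p - 1) = 1) ∧ (∀ τ : absoluteGaloisGroup ℚ, ψ τ ^ (p - 1) = 1) ∧
      (∀ u : HeightOneSpectrum (𝓞 ℚ), (((N * p : ℕ) : ℤ) : 𝓞 ℚ) ∉ u.asIdeal → φ.IsUnramifiedAt u) ∧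
      (∀ u : HeightOneSpectrum (𝓞 ℚ), (((N * p : ℕ) : ℤ) : 𝓞 ℚ) ∉ u.asIdeal → ψ.IsUnramifiedAt u) ∧
      (∀ τ : absoluteGaloisGroup ℚ,
        ((entry (∅ : Set (PadicAlgCl p)) ψ τ : padicCoeffIntegers (∅ : Set (PadicAlgCl p))) : PadicAlgCl p) *
            ((entry (∅ : Set (PadicAlgCl p)) φ τ : padicCoeffIntegers (∅ : Set (PadicAlgCl p))) :
              PadicAlgCl p) =
          algebraMap ℚ_[p] (PadicAlgCl p)
            (((Kato2004.teichmullerChar p (modPCyclotomicCharacterZMod ℚ p τ) : ℤ_[p]ˣ) : ℤ_[p]) : ℚ_[p])) := by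
    rcases hφψ with ⟨rfl, rfl⟩ | ⟨rfl, rfl⟩
    · exact ⟨hTsub, hTquot, hsubC, hquotC, fun τ ↦ by rw [mul_comm]; exact hdet0 τ⟩
    · exact ⟨hTquot, hTsub, hquotC, hsubC, hdet0⟩
  obtain ⟨hTφ, hTψ, hφC, hψC, hdet⟩ := hpairφψ
  have hφC' : ∀ u : HeightOneSpectrum (𝓞 ℚ), (((N * p : ℕ) : ℤ) : 𝓞 ℚ) ∉ u.asIdeal → φ.IsUnramifiedAt u := hφC
  have hψev : ∀ᶠ u : HeightOneSpectrum (𝓞 ℚ) in cofinite, ψ.IsUnramifiedAt u :=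
    eventually_isUnramifiedAt_of_forall_not_mem ψ hC0 hψC
  -- `ψ|_K ≠ 𝟙`
  have hnt : ∃ σ : absoluteGaloisGroup K, ψ.restrictField K σ ≠ 1 :=
    restrictField_ne_one_of_entry_mul_eq_teichmullerChar hK.1 hp h𝔭 h𝔭bar hne hdet hφp
  exact ResidualPairMuLambdaOfPub.omegaSide_of_pub_of_firstUnit h331 h411 hF hO1 hp hK hHp hodd h3 hιv h𝔭bar hne
    hκ hι' hTφ hTψ hC0 hC hφC' hφp hψev hdet hnt hθK hCbar hΩK' hL hnφ Dψ

/-! ## §2 Crux 4's [BRω-mult] HEAVY binder from four published named facts -/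

/-- **[BRω-mult] HEAVY — the `hω` binder of `CharGrSelmerCorankGeOfFacts.imprimitiveCount_nonsplit_of_an_of_brPrinted_of_ge` (and of p668130''/
`…NonsplitOfPrint`), text VERBATIM**, from Bleher et al. 2020 Thm. 3.3.1, Greenberg 2016 Prop. 4.1.1, de Shalit II.6.4, Hida 2010 Thm. I (§1 at the
non-split datum; the X2c Heegner-datum binders are idle). Replaces `brOmegaMult_heavy_of_light (brOmegaMult_light_of_print hfe)` in V8–V18, i.e. makes the
cite conjunct `thm122_fe_omegaPartner_charGrDual_torsion_muZero_lambda_eq` redundant. [cite: KellerYin2024, §5.1 (b), Lemma 5.1.2, Thm. 1.2.2 (arXiv:2402.12781v2) (shape only)]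
[cite: CastellaGrossiLeeSkinner2022, Thm. 1.2.2 with (2.16)] [cite: BleherEtAl2020, §3.3 Thm. 3.3.1] [cite: Greenberg2016Selmer, Prop. 4.1.1]
[cite: deShalit1987, II.6.4] [cite: Hida2010MuInvariant, Thm. I] -/
theorem brOmegaMultHeavy_of_pub
    (h331 : thm331_rubin_exists_katzMeasure₂_pseudoIso_span_eq)
    (h411 : prop411_selmer_isAlmostDivisible)
    (hF : thmII64_katzMeasure₂_functionalEquation) (hO1 : thmI_mu_katzBranch_reflect_eq_zero) :
    (∀ (W : WeierstrassCurve ℚ) [W.IsElliptic] [W.IsGloballyMinimal] (p : ℕ) [Fact p.Prime],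
      ∀ (N : ℕ) [NeZero N] (K : Type) [Field K] [NumberField K] (Dt : ModularParametrizationData W N)
        (H : HeegnerDatum N (NumberField.discr K)) (ιK : K →+* ℂ) (P : (W.baseChange K).toAffine.Point),
        CellC W p → ¬ W.HasSplitMultiplicativeReductionAtPrime p → W.conductorNorm ℤ = N →
        IsImaginaryQuadratic K → NumberField.discr K < -4 → SatisfiesHeegnerHypothesis N K →
        (W.quadraticTwist (NumberField.discr K : ℚ)).entireLFunction 1 ≠ 0 →
        WeierstrassCurve.Affine.Point.map ιK.toRatAlgHom P = heegnerPointComplex Dt H →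
        ¬ (p : ℤ) ∣ Dt.c → ¬ IsOfFinAddOrder P →
        Odd (NumberField.discr K) →
        ∀ (κ : ZpExtension K p), κ.IsAnticyclotomic →
          ∀ (γ : Field.absoluteGaloisGroup K) [Fact (κ.IsTopGenerator γ)]
            (𝔭 : HeightOneSpectrum (𝓞 K)), ((p : ℕ) : 𝓞 K) ∈ 𝔭.asIdeal →
            𝔭.asIdeal.ramificationIdx (𝓞 ℚ) = 1 → 𝔭.asIdeal.inertiaDeg (𝓞 ℚ) = 1 →
            ∀ (𝔭bar : HeightOneSpectrum (𝓞 K)), ((p : ℕ) : 𝓞 K) ∈ 𝔭bar.asIdeal → 𝔭bar ≠ 𝔭 →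
              ((Ideal.span {(p : ℤ)}).primesOver (𝓞 K)).ncard = 2 →
            ∀ (ι' : PadicAlgCl p ≃+* ℂ),
                (∀ (w : InfinitePlace K) (k : 𝓞 K),
                  k ∈ 𝔭.asIdeal ↔ ‖ι'.symm (w.embedding (k : K))‖ < 1) →
                    ∀ (Φ : AddSubgroup (geomTorsion W (p : ℤ))), IsRationalLine W p Φ →
                    ∀ (θsub θquot : FramedGaloisRep ℚ (padicCoeffIntegers (∅ : Set (PadicAlgCl p))) 1),
                      IsTeichmullerLiftOn (∅ : Set (PadicAlgCl p)) (Φ.map (geomTorsion W (p : ℤ)).subtype) θsub →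
                      IsTeichmullerLiftOnQuot (∅ : Set (PadicAlgCl p)) (Φ.map (geomTorsion W (p : ℤ)).subtype)
                        (geomTorsion W (p : ℤ)) θquot →
                    ∀ (φ ψ : FramedGaloisRep ℚ (padicCoeffIntegers (∅ : Set (PadicAlgCl p))) 1),
                      (φ = θsub ∧ ψ = θquot ∨ φ = θquot ∧ ψ = θsub) →
                      (∀ u : HeightOneSpectrum (𝓞 ℚ), ((p : ℕ) : 𝓞 ℚ) ∈ u.asIdeal → φ.IsUnramifiedAt u) →
                    ∀ (θK : HeckeCharacter K), IsHeckeCharOf ι' (φ.restrictField K) θK →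
                    ∀ (Cbar : Finset (HeightOneSpectrum (𝓞 K))), (∀ u ∈ Cbar, ¬ θK.IsUnramifiedAt u) →
                    ∀ (ΩK' : ℂ) (Ωp' : (unrIntegers p)ˣ) (Lφ : UnrSeries p), ΩK' ≠ 0 →
                      IsKatzLFunction ι' 𝔭 𝔭bar Cbar κ γ θK ΩK' ((Ωp' : unrIntegers p) : ℂ_[p]) Lφ →
                    ∀ nφ : ℕ, FirstUnitCoeffAt Lφ nφ →
                    ∀ (Dψ : DatumDualData κ γ (charModule (∅ : Set (PadicAlgCl p)) (ψ.restrictField K))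
                        (Castella2018.AcSelmer.bdpData (charModule (∅ : Set (PadicAlgCl p)) (ψ.restrictField K)) p 𝔭bar)
                        (∅ : Set (HeightOneSpectrum (𝓞 K)))),
                      Module.Finite (IwasawaAlgebra p) Dψ.X ∧ Module.IsTorsion (IwasawaAlgebra p) Dψ.X ∧
                        muInvariant p Dψ.X = 0 ∧ lambdaInvariant p Dψ.X = nφ) := by
  intro W _ _ p _ N _ K _ _ Dt H ιK P hc hns hN hK hd4 hHN hL1 hP hcp hPt hodd κ hκ γ _ 𝔭 h𝔭 he1 hf1 𝔭bar h𝔭bar hne hsplit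
    ι' hι' Φ hΦ θsub θquot hsub hquot φ ψ hφψ hφp θK hθK Cbar hCbar ΩK' Ωp' Lφ hΩK' hL nφ hnφ Dψ
  have hp2 : 2 < p := by
    have hp' := (Fact.out : p.Prime).two_le
    rcases hp'.lt_or_eq with h | h
    · exact h
    · exact absurd h.symm hc.2.1
  have hHN' : SatisfiesHeegnerHypothesis (W.conductorNorm ℤ) K := hN ▸ hHN
  have hd3 : NumberField.discr K ≠ -3 := by omega
  exact omegaSideTeichmullerPair_of_pub h331 h411 hF hO1 W p hp2 K hK hHN' hodd hd3 κ hκ γ 𝔭 h𝔭 he1 hf1 𝔭bar h𝔭bar hne hsplit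
    ι' hι' Φ hΦ θsub θquot hsub hquot φ ψ hφψ hφp θK hθK Cbar hCbar ΩK' Ωp' Lφ hΩK' hL nφ hnφ Dψ

end Summit.BirchSwinnertonDyer.BirchSwinnertonDyer.Theorems.BrOmegaMultHeavyOfPub

end
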